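import Literature.MathematicalPhysics.KineticTheory.TaggedSphereCarlemanMoment
import Literature.MathematicalPhysics.KineticTheory.TaggedSphereDiffusionCorrector
import HarnessLib

/-!
# From `L¹(M_β)` to pointwise smallness of the hard-sphere gain term, and the explicit relaxation
(towards BGSR (6.3): Bodineau–Gallagher–Saint-Raymond, Invent. Math. 203 (2016) =
arXiv:1305.3397v2, §6.1.3; a layer of the bottom-up proof of the named fact
`Literature.MathematicalPhysics.KineticTheory.bgsr_hydrodynamicLimit` of `TaggedSphereDiffusion`)

The last step of the velocity-only form of (6.3) reads the mode amplitude through one more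
Duhamel iteration, `G(τ, v) = e^{-zτ} + α² ∫₀^τ e^{-z(τ-σ)} (K⁺_β G(σ))(v) dσ`,
`z = α² a_β(v) + i α ω(v)`, and needs two estimates, PROVED here:

* `integral_carlemanKernel_mul_le_split` — **the gain of a bounded function is pointwise small when
  it is small in `L¹(M_β)`**: for measurable `0 ≤ h ≤ B`, every `Λ > 0` and every `v`,
  `∫ k_β(v, u) h(v + u) du ≤ Λ ∫ h M_β + B Λ^{-θ} M_β(v)^{-θ} C_θ`, with `C_θ` the uniform mixed
  moment `∫ k_β(v, u) k_β(v + u, -u)^θ du ≤ C_θ` of `TaggedSphereCarlemanMoment`; the split is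
  according to the size of `ρ_v(u) = k_β(v, u)/M_β(v + u) = k_β(v + u, -u)/M_β(v)` (detailed balance,
  `maxwellianBeta_mul_carlemanKernel_symm`).
* `norm_explicitRelaxation_sub_le` — **the explicit part relaxes**: with `Re z = α² a ≥ 2λ ≥ 0`,
  `‖(e^{-λτ} - e^{-zτ})(λ - i α ω)/(z - λ)‖ ≤ 4 (λ + α|ω|)/(α² a)` for `τ ≥ 0`
  (`|e^{-λτ}|, |e^{-zτ}| ≤ 1`, `|z - λ| ≥ α² a - λ ≥ α² a/2`).

## References

* T. Bodineau, I. Gallagher, L. Saint-Raymond, *The Brownian motion as the limit of a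
  deterministic system of hard-spheres*, Invent. Math. 203 (2016) 493–553 = arXiv:1305.3397v2,
  §6.1.2–6.1.3.
-/

open MeasureTheory Metric Set Filter Topology ProbabilityTheory
open scoped InnerProductSpace ENNReal NNReal

namespace Literature.MathematicalPhysics.KineticTheory

noncomputable section

open Literature.Analysis.FunctionSpaces (maxwellianBeta maxwellianBeta_pos)
open TaggedSphereDiffusion (collisionFrequency)

variable {d : Type*} [Fintype d] {β : ℝ}

/-! ## The split of the gain term -/

/-- **Pointwise split of the gain integrand** according to the size of
`ρ = k_β(v, u)/M_β(v + u)`: for `0 ≤ h ≤ B`, `Λ > 0`, `θ ≥ 0`,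
`k_β(v,u) h(v+u) ≤ Λ M_β(v+u) h(v+u) + B Λ^{-θ} M_β(v)^{-θ} k_β(v,u) k_β(v+u,-u)^θ`
(if `ρ ≤ Λ` the first term dominates; if `ρ > Λ` then `k_β(v+u,-u) = M_β(v) ρ > M_β(v) Λ` by detailed
balance and the second term dominates `B k_β(v,u)`). [folklore] -/
theorem carlemanKernel_mul_le_split (hβ : 0 < β) {h : EuclideanSpace ℝ d → ℝ} {B : ℝ}
    (hh0 : ∀ w, 0 ≤ h w) (hhB : ∀ w, h w ≤ B) {Λ : ℝ} (hΛ : 0 < Λ) {θ : ℝ} (hθ : 0 ≤ θ)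
    (v u : EuclideanSpace ℝ d) :
    carlemanKernel β v u * h (v + u) ≤
      Λ * (maxwellianBeta β (v + u) * h (v + u)) +
        B * Λ ^ (-θ) * maxwellianBeta β v ^ (-θ) * (carlemanKernel β v u * carlemanKernel β (v + u) (-u) ^ θ) := by
  have hk := carlemanKernel_nonneg β v u
  have hk' := carlemanKernel_nonneg β (v + u) (-u)
  have hM := maxwellianBeta_pos hβ v
  have hMu := maxwellianBeta_pos hβ (v + u)
  have hB : 0 ≤ B := (hh0 v).trans (hhB v)
  have hsymm := maxwellianBeta_mul_carlemanKernel_symm hβ v u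
  have t1 : 0 ≤ Λ * (maxwellianBeta β (v + u) * h (v + u)) := mul_nonneg hΛ.le (mul_nonneg hMu.le (hh0 _))
  have t2 : 0 ≤ B * Λ ^ (-θ) * maxwellianBeta β v ^ (-θ) *
      (carlemanKernel β v u * carlemanKernel β (v + u) (-u) ^ θ) := by positivity
  by_cases hcase : carlemanKernel β v u ≤ Λ * maxwellianBeta β (v + u)
  · -- small density: the first term dominates
    calc carlemanKernel β v u * h (v + u) ≤ Λ * maxwellianBeta β (v + u) * h (v + u) :=
          mul_le_mul_of_nonneg_right hcase (hh0 _)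
      _ = Λ * (maxwellianBeta β (v + u) * h (v + u)) := by ring
      _ ≤ _ := le_add_of_nonneg_right t2
  · -- large density: `k(v+u,-u) > M(v) Λ`, the second term dominates `B k`
    push Not at hcase
    have hrev : Λ * maxwellianBeta β v < carlemanKernel β (v + u) (-u) := by
      -- `M(v+u) k(v+u,-u) = M(v) k(v,u) > M(v) Λ M(v+u)`
      have : maxwellianBeta β v * (Λ * maxwellianBeta β (v + u)) <
          maxwellianBeta β (v + u) * carlemanKernel β (v + u) (-u) := by
        rw [← hsymm]; exact mul_lt_mul_of_pos_left hcase hM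
      nlinarith
    have hpow : (Λ * maxwellianBeta β v) ^ θ ≤ carlemanKernel β (v + u) (-u) ^ θ :=
      Real.rpow_le_rpow (by positivity) hrev.le hθ
    have hkey : carlemanKernel β v u * h (v + u) ≤
        B * Λ ^ (-θ) * maxwellianBeta β v ^ (-θ) * (carlemanKernel β v u * carlemanKernel β (v + u) (-u) ^ θ) := by
      calc carlemanKernel β v u * h (v + u) ≤ carlemanKernel β v u * B := mul_le_mul_of_nonneg_left (hhB _) hk
        _ = B * Λ ^ (-θ) * maxwellianBeta β v ^ (-θ) * (carlemanKernel β v u * (Λ * maxwellianBeta β v) ^ θ) := by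
            rw [Real.mul_rpow hΛ.le hM.le, Real.rpow_neg hΛ.le, Real.rpow_neg hM.le]
            field_simp
        _ ≤ B * Λ ^ (-θ) * maxwellianBeta β v ^ (-θ) * (carlemanKernel β v u * carlemanKernel β (v + u) (-u) ^ θ) := by
            refine mul_le_mul_of_nonneg_left (mul_le_mul_of_nonneg_left hpow hk) ?_
            positivity
    exact hkey.trans (le_add_of_nonneg_left t1)

/-- **The gain of a bounded function is pointwise controlled by its `L¹(M_β)` norm**: for
measurable `0 ≤ h ≤ B`, `Λ > 0` and `θ` as in the kernel-moment bound (`0 < θ`, `θ(d-2) ≤ 1`, with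
constant `C_θ`), `∫ k_β(v,u) h(v+u) du ≤ Λ ∫ h M_β + B Λ^{-θ} M_β(v)^{-θ} C_θ` for every `v`.
[cite: BodineauGallagherSaintRaymondInvent2016, §6.1.3] -/
theorem integral_carlemanKernel_mul_le_split (hd : 2 ≤ Fintype.card d) (hβ : 0 < β)
    {θ : ℝ} (hθ : 0 < θ) {C : ℝ≥0∞} (hC : C < ∞)
    (hCθ : ∀ v : EuclideanSpace ℝ d,
      ∫⁻ u, ENNReal.ofReal (carlemanKernel β v u * carlemanKernel β (v + u) (-u) ^ θ) ≤ C)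
    {h : EuclideanSpace ℝ d → ℝ} (hhm : Measurable h) {B : ℝ} (hh0 : ∀ w, 0 ≤ h w) (hhB : ∀ w, h w ≤ B)
    {Λ : ℝ} (hΛ : 0 < Λ) (v : EuclideanSpace ℝ d) :
    ∫ u, carlemanKernel β v u * h (v + u) ≤
      Λ * (∫ w, h w * maxwellianBeta β w) + B * Λ ^ (-θ) * maxwellianBeta β v ^ (-θ) * C.toReal := by
  have hB : 0 ≤ B := (hh0 v).trans (hhB v)
  have habs : ∀ w, |h w| ≤ B := fun w => by rw [abs_of_nonneg (hh0 w)]; exact hhB w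
  -- integrability of the pieces
  have hMh : Integrable fun w => h w * maxwellianBeta β w := by
    refine ((KineticTheory.integrable_maxwellianBeta (d := d) hβ).const_mul B).mono'
      (hhm.mul (measurable_maxwellianBeta β)).aestronglyMeasurable (Eventually.of_forall fun w => ?_)
    rw [Real.norm_eq_abs, abs_mul, abs_of_nonneg (maxwellianBeta_pos hβ w).le]
    exact mul_le_mul_of_nonneg_right (habs w) (maxwellianBeta_pos hβ w).le
  have hMh' : Integrable fun u => maxwellianBeta β (v + u) * h (v + u) := by
    have := hMh.comp_add_left v
    exact this.congr (Eventually.of_forall fun u => by ring)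
  have hkkm : Measurable fun u : EuclideanSpace ℝ d => carlemanKernel β v u * carlemanKernel β (v + u) (-u) ^ θ :=
    (measurable_carlemanKernel_right β v).mul
      (((measurable_carlemanKernel β).comp ((measurable_const_add v).prodMk measurable_neg)).pow_const θ)
  have hkk0 : ∀ u, 0 ≤ carlemanKernel β v u * carlemanKernel β (v + u) (-u) ^ θ := fun u =>
    mul_nonneg (carlemanKernel_nonneg β v u) (Real.rpow_nonneg (carlemanKernel_nonneg β _ _) _)
  have hkki : Integrable fun u : EuclideanSpace ℝ d => carlemanKernel β v u * carlemanKernel β (v + u) (-u) ^ θ := by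
    refine ⟨hkkm.aestronglyMeasurable, ?_⟩
    have : ∫⁻ u, ‖carlemanKernel β v u * carlemanKernel β (v + u) (-u) ^ θ‖ₑ =
        ∫⁻ u, ENNReal.ofReal (carlemanKernel β v u * carlemanKernel β (v + u) (-u) ^ θ) :=
      lintegral_congr fun u => by rw [Real.enorm_of_nonneg (hkk0 u)]
    show ∫⁻ u, ‖carlemanKernel β v u * carlemanKernel β (v + u) (-u) ^ θ‖ₑ < ∞
    rw [this]
    exact (hCθ v).trans_lt hC
  have hkh : Integrable fun u => carlemanKernel β v u * h (v + u) := by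
    refine ((integrable_carlemanKernel hd hβ v).mul_const B).mono'
      ((measurable_carlemanKernel_right β v).mul (hhm.comp (measurable_const_add v))).aestronglyMeasurable
      (Eventually.of_forall fun u => ?_)
    rw [Real.norm_eq_abs, abs_mul, abs_of_nonneg (carlemanKernel_nonneg β v u)]
    exact mul_le_mul_of_nonneg_left (habs _) (carlemanKernel_nonneg β v u)
  -- integrate the pointwise split
  have hpt := fun u => carlemanKernel_mul_le_split hβ hh0 hhB hΛ hθ.le v u
  calc ∫ u, carlemanKernel β v u * h (v + u)
      ≤ ∫ u, (Λ * (maxwellianBeta β (v + u) * h (v + u)) +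
          B * Λ ^ (-θ) * maxwellianBeta β v ^ (-θ) * (carlemanKernel β v u * carlemanKernel β (v + u) (-u) ^ θ)) :=
        integral_mono hkh ((hMh'.const_mul Λ).add (hkki.const_mul _)) hpt
    _ = Λ * (∫ u, maxwellianBeta β (v + u) * h (v + u)) +
          B * Λ ^ (-θ) * maxwellianBeta β v ^ (-θ) * ∫ u, carlemanKernel β v u * carlemanKernel β (v + u) (-u) ^ θ := by
        rw [integral_add (hMh'.const_mul Λ) (hkki.const_mul _), integral_const_mul, integral_const_mul]
    _ ≤ Λ * (∫ w, h w * maxwellianBeta β w) + B * Λ ^ (-θ) * maxwellianBeta β v ^ (-θ) * C.toReal := by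
        refine add_le_add (le_of_eq ?_) (mul_le_mul_of_nonneg_left ?_
          (mul_nonneg (mul_nonneg hB (Real.rpow_nonneg hΛ.le _)) (Real.rpow_nonneg (maxwellianBeta_pos hβ v).le _)))
        · -- translation invariance
          congr 1
          rw [← integral_add_left_eq_self (fun w => h w * maxwellianBeta β w) v]
          refine integral_congr_ae (Eventually.of_forall fun u => ?_)
          simp only; ring
        · -- the kernel moment
          rw [integral_eq_lintegral_of_nonneg_ae (Eventually.of_forall hkk0) hkkm.aestronglyMeasurable]
          exact ENNReal.toReal_mono hC.ne (hCθ v)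

/-! ## The explicit relaxation -/

/-- **The explicit part of the Duhamel formula relaxes to the heat multiplier**: for `τ ≥ 0`,
`z = α² a + i α ω` with `α² a ≥ 2λ`, `λ ≥ 0`, `a > 0`:
`‖(e^{-λτ} - e^{-zτ}) (λ - i α ω) / (z - λ)‖ ≤ 4 (λ + α |ω|) / (α² a)`. [folklore] -/
theorem norm_explicitRelaxation_sub_le {lam a α ω τ : ℝ} (hlam : 0 ≤ lam) (ha : 0 < a) (hα : 0 < α)
    (hbig : 2 * lam ≤ α ^ 2 * a) (hτ : 0 ≤ τ) :
    ‖(Complex.exp (-(lam : ℂ) * τ) - Complex.exp (-((α ^ 2 * a : ℝ) + (α * ω : ℝ) * Complex.I) * τ)) *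
        ((lam : ℂ) - (α * ω : ℝ) * Complex.I) / (((α ^ 2 * a : ℝ) + (α * ω : ℝ) * Complex.I) - lam)‖ ≤
      4 * (lam + α * |ω|) / (α ^ 2 * a) := by
  have hαa : 0 < α ^ 2 * a := by positivity
  -- the three factors
  have h1 : ‖Complex.exp (-(lam : ℂ) * τ) - Complex.exp (-((α ^ 2 * a : ℝ) + (α * ω : ℝ) * Complex.I) * τ)‖ ≤ 2 := by
    refine (norm_sub_le _ _).trans ?_
    have e1 : ‖Complex.exp (-(lam : ℂ) * τ)‖ ≤ 1 := by
      rw [Complex.norm_exp]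
      simp only [neg_mul, Complex.neg_re, Complex.mul_re, Complex.ofReal_re, Complex.ofReal_im, mul_zero,
        sub_zero, Real.exp_le_one_iff, neg_nonpos]
      exact mul_nonneg hlam hτ
    have e2 : ‖Complex.exp (-((α ^ 2 * a : ℝ) + (α * ω : ℝ) * Complex.I) * τ)‖ ≤ 1 := by
      rw [Complex.norm_exp]
      simp only [neg_mul, Complex.neg_re, Complex.mul_re, Complex.add_re, Complex.ofReal_re, Complex.mul_im,
        Complex.ofReal_im, Complex.I_re, Complex.I_im, Complex.add_im, mul_zero, mul_one, zero_add, add_zero,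
        sub_zero, Real.exp_le_one_iff, neg_nonpos]
      positivity
    linarith
  have h2 : ‖(lam : ℂ) - (α * ω : ℝ) * Complex.I‖ ≤ lam + α * |ω| := by
    refine (norm_sub_le _ _).trans ?_
    rw [Complex.norm_real, Real.norm_of_nonneg hlam, norm_mul, Complex.norm_I, mul_one, Complex.norm_real,
      Real.norm_eq_abs, abs_mul, abs_of_pos hα]
  have h3 : α ^ 2 * a / 2 ≤ ‖((α ^ 2 * a : ℝ) + (α * ω : ℝ) * Complex.I) - lam‖ := by
    refine le_trans ?_ (Complex.abs_re_le_norm _)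
    simp only [Complex.sub_re, Complex.add_re, Complex.ofReal_re, Complex.mul_re, Complex.ofReal_im,
      Complex.I_re, Complex.I_im, mul_zero, mul_one, sub_zero, add_zero]
    rw [le_abs]
    left
    linarith
  have h3pos : 0 < ‖((α ^ 2 * a : ℝ) + (α * ω : ℝ) * Complex.I) - lam‖ := lt_of_lt_of_le (by positivity) h3
  rw [norm_div, norm_mul, div_le_div_iff₀ h3pos hαa]
  calc ‖Complex.exp (-(lam : ℂ) * τ) - Complex.exp (-((α ^ 2 * a : ℝ) + (α * ω : ℝ) * Complex.I) * τ)‖ *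
        ‖(lam : ℂ) - (α * ω : ℝ) * Complex.I‖ * (α ^ 2 * a)
      ≤ 2 * (lam + α * |ω|) * (α ^ 2 * a) := by
        refine mul_le_mul_of_nonneg_right (mul_le_mul h1 h2 (norm_nonneg _) (by norm_num)) hαa.le
    _ = 4 * (lam + α * |ω|) * (α ^ 2 * a / 2) := by ring
    _ ≤ 4 * (lam + α * |ω|) * ‖((α ^ 2 * a : ℝ) + (α * ω : ℝ) * Complex.I) - lam‖ := by
        refine mul_le_mul_of_nonneg_left h3 (by positivity)

end

end Literature.MathematicalPhysics.KineticTheory
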